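import Summits.QuantumFields.BalabanUV.T4Continuum.Support.NE7K1LinSchurLineU1Energy

/-!
# NE7K1LinSchurLineU1EnergyBounds — row NE7 (node U5), candidate route HOM, path H1L, cell K1-lin(s): THE TWO ENERGY BOUNDS AND THE TWO
# EXTRACTION LEMMAS OF B4 COROLLARY 2.3's METHOD ON THE √s-EXTENDED TWO-CUTOFF SYSTEM (file 91 continued) — `E ≤ (4∕σ)‖g‖²` for a
# coarse source `g`, `E ≤ 8(1 + 4δ²∕σ)‖f′‖²` for a coarse source `D_ν^⊤f′`, and `Σ_S v_c² ≤ e^{−2δρ₀}E∕σ`,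
# `Σ_S(D_μv_c)² ≤ 2e^{−2δρ₀}(1 + 4δ²∕σ)E` on a set at `η`-distance `≥ ρ₀` from the source — EVERY `s ∈ [0,1]`, EVERY mesh

Lineage `b2b-balaban-t4-ne7-p2` (CRUX PROVER NE7 #2), generation 78; file 92.  b04's `B4Cor23Zero.energyA ∕ energyB ∕ sum_sq_le_energy ∕
sum_fdiff_sq_le_energy` with `H = 𝒫(s)` (file 91's `extU1`), the weight `ρ_T` (file 91's `rhoT`), the Dirichlet domination
`sum_fdiff_sq_le_extU1` in place of `sum_fdiff_sq_le_form`, and `σ = min(2,a)∕L^{d+1}`.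

* **`extU1_isUnit_det`**, **`energyA_ext`**, `coarse_normSq_le_energy`, **`energyB_ext`**, **`sum_sq_le_extEnergy`**, **`sum_fdiff_sq_le_extEnergy`**.

HONEST FRAMING: [folklore]; A = 0; nothing printed asserted; no `sorry`.  Census only; NE7 NOT PRINTED ∕ NOT PROVED; spine 0∕9; FIXED FINITE
T⁴, rung (B)+1; NOT infinite volume, NOT mass gap, NOT Clay.  HONEST DEPENDENCY: continuum YM on T⁴ ⇐ BetaPertH ∧ nine spine estimates (0/9
proved); BetaPertH ⇐ (D1) ∧ (D4) ∧ CAP+tail; G-an2-4 gates asym, D1 and NE2/3/4.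
-/

noncomputable section

open Finset Matrix

namespace Summit.QuantumFields.BalabanUV.T4Continuum.NE7K1LinSchurLineU1Energy

open Literature.MathematicalPhysics.QuantumFieldTheory.Balaban1983to89
open Literature.MathematicalPhysics.QuantumFieldTheory.Balaban1983to89.B4ContourShift (supNorm supNorm_nonneg)
open Literature.MathematicalPhysics.QuantumFieldTheory.Balaban1983to89.B4Reflection242
open Literature.MathematicalPhysics.QuantumFieldTheory.Balaban1983to89.B4BoxCov237
open Literature.MathematicalPhysics.QuantumFieldTheory.Balaban1983to89.B4Lower18
open Literature.MathematicalPhysics.QuantumFieldTheory.Balaban1983to89.B4Cor23Zero (fdiff fdiffT extR dot_fdiffT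
  sum_fdiff_sq_le_form sum_sq_shift_le abs_fdiff_weighted_le exp_mul_abs_fdiff_le energy_le_two_conjPairing
  le_four_mul_of_sq_le sq_sum_mul_le add_uvec_mem_nbrs)
open Literature.MathematicalPhysics.QuantumFieldTheory.Balaban1983to89.Beta.CombesThomasFormOp (setSq_le_of_weightedSq
  weightedSq_le_of_support)
open NE7K1LinSchurLineForm NE7K1LinSchurLineCoords NE7K1LinFineOpWeight NE7K1LinBlockCoords NE7K1LinSchurLineU1
open NE7K1LinTwoRunKit NE7K1LinTwoRunUpper NE7K1LinTwoRunJensen NE7K1LinSchurLineU1Set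

variable {d : ℕ}

/-! ### §4 The two energy bounds and the two extraction lemmas on the extended system -/

section Energy

variable {n L : ℕ} [NeZero L] {R' : Finset (Fin (d + 1) → ℤ)}

/-- `𝒫(s)` is invertible (`s ∈ [0,1]`, `a > 0`). [folklore] -/
theorem extU1_isUnit_det (hn : 1 ≤ n) (hR' : IsBlockUnion (n * L) R') {a : ℝ} (ha : 0 < a) {s : ℝ} (hs0 : 0 ≤ s) (hs1 : s ≤ 1) :
    IsUnit (extU1 (isBlockUnion_fine hR') n a s).det := by
  have hL0 : (0 : ℝ) < L := by exact_mod_cast (NeZero.one_le : 1 ≤ L)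
  have hσ : 0 < min 2 a / (L : ℝ) ^ (d + 1) := div_pos (lt_min (by norm_num) ha) (by positivity)
  obtain ⟨T, hT⟩ : ∃ T : Finset ↥(R'.image (blk L)), True := ⟨∅, trivial⟩
  refine isUnit_det_of_coercive _ hσ fun w => ?_
  have hHB : fromBlocks (runB (isBlockUnion_fine hR') n a).toBlocks₁₁ (runB (isBlockUnion_fine hR') n a).toBlocks₁₂
      (runB (isBlockUnion_fine hR') n a).toBlocks₂₁ (runB (isBlockUnion_fine hR') n a).toBlocks₂₂ = runB (isBlockUnion_fine hR') n a :=
    fromBlocks_toBlocks _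
  refine coercive_extOpR _ _ _ _ _ (fun g => ?_) (by rw [hHB]; exact fun u => runB_coercive hn hR' ha u) hs0 hs1 w
  have hg : 0 ≤ g ⬝ᵥ g := by simp only [dotProduct]; exact Finset.sum_nonneg fun _ _ => mul_self_nonneg _
  have hLpow1 : (1 : ℝ) ≤ (L : ℝ) ^ (d + 1) := one_le_pow₀ (by exact_mod_cast (NeZero.one_le : 1 ≤ L))
  exact (mul_le_mul_of_nonneg_right (div_le_self (lt_min (by norm_num) ha).le hLpow1) hg).trans
    (lower18_zero hn ha.le (isBlockUnion_coarse NeZero.one_le hR') g)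

/-- **ENERGY BOUND, CASE A, FOR `𝒫(s)`**: source `(g, 0)` with `supp g ⊆ T`: `⟨ŵ, 𝒫(s)ŵ⟩ ≤ (4∕σ)Σg²`, `ŵ = e^{ρ_T}𝒫(s)⁻¹(g,0)`.
[folklore] -/
theorem energyA_ext (hn : 1 ≤ n) (hR' : IsBlockUnion (n * L) R') {a δ : ℝ} (ha : 0 < a) (hδ0 : 0 ≤ δ) (hδ1 : δ ≤ 1)
    (hsmall : 2 * (2 * ((d : ℝ) + 1) * (δ * L) ^ 2 + a * (Real.exp δ - 1)) ≤ (min 2 a / (L : ℝ) ^ (d + 1)) / 2)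
    {s : ℝ} (hs0 : 0 ≤ s) (hs1 : s ≤ 1) (T : Finset ↥(R'.image (blk L))) (hT : T.Nonempty)
    (g : ↥(R'.image (blk L)) → ℝ) (hg : ∀ x, x ∉ T → g x = 0) (w : ↥(R'.image (blk L)) ⊕ (↥(R'.image (blk L)) × NZ d L) → ℝ)
    (hw : ∀ j, w j = Real.exp (rhoT n δ T hT j) * ((extU1 (isBlockUnion_fine hR') n a s)⁻¹.mulVec (Sum.elim g 0)) j) :
    w ⬝ᵥ (extU1 (isBlockUnion_fine hR') n a s).mulVec w ≤ 4 / (min 2 a / (L : ℝ) ^ (d + 1)) * ∑ x, g x ^ 2 := by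
  classical
  have hL0 : (0 : ℝ) < L := by exact_mod_cast (NeZero.one_le : 1 ≤ L)
  have hσ : 0 < min 2 a / (L : ℝ) ^ (d + 1) := div_pos (lt_min (by norm_num) ha) (by positivity)
  obtain ⟨hpos, herr⟩ := extU1_hyps hn hR' ha hδ0 hδ1 hsmall hs0 hs1 T hT
  have hv : (extU1 (isBlockUnion_fine hR') n a s).mulVec ((extU1 (isBlockUnion_fine hR') n a s)⁻¹.mulVec (Sum.elim g 0)) =
      Sum.elim g 0 := by
    rw [Matrix.mulVec_mulVec, Matrix.mul_nonsing_inv _ (extU1_isUnit_det hn hR' ha hs0 hs1), Matrix.one_mulVec]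
  have h := energy_le_of_supp _ hσ (rhoT n δ T hT) hpos herr (T.map ⟨Sum.inl, Sum.inl_injective⟩) (fun j hj => ?_)
    (Sum.elim g 0) _ w (fun j hj => NE7K1LinSchurLineSetDecay.elim_zero_of_not_mem_map g hg j hj) hv hw
  · rw [NE7K1LinSchurLineSetDecay.sum_sq_elim_zero] at h
    exact h
  · obtain ⟨x, hx, rfl⟩ := Finset.mem_map.1 hj
    exact mul_nonpos_iff.2 (Or.inl ⟨hδ0, dT_le_zero_of_mem T hT hx⟩)

/-- `‖w_c‖² ≤ ‖ŵ‖² ≤ E∕σ`. [folklore] -/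
theorem coarse_normSq_le_energy (hn : 1 ≤ n) (hR' : IsBlockUnion (n * L) R') {a : ℝ} (ha : 0 < a) {s : ℝ} (hs0 : 0 ≤ s)
    (hs1 : s ≤ 1) (w : ↥(R'.image (blk L)) ⊕ (↥(R'.image (blk L)) × NZ d L) → ℝ) :
    ∑ x, (w ∘ Sum.inl) x ^ 2 ≤ (w ⬝ᵥ (extU1 (isBlockUnion_fine hR') n a s).mulVec w) / (min 2 a / (L : ℝ) ^ (d + 1)) := by
  have hL0 : (0 : ℝ) < L := by exact_mod_cast (NeZero.one_le : 1 ≤ L)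
  have hσ : 0 < min 2 a / (L : ℝ) ^ (d + 1) := div_pos (lt_min (by norm_num) ha) (by positivity)
  have hHB : fromBlocks (runB (isBlockUnion_fine hR') n a).toBlocks₁₁ (runB (isBlockUnion_fine hR') n a).toBlocks₁₂
      (runB (isBlockUnion_fine hR') n a).toBlocks₂₁ (runB (isBlockUnion_fine hR') n a).toBlocks₂₂ = runB (isBlockUnion_fine hR') n a :=
    fromBlocks_toBlocks _
  have hLpow1 : (1 : ℝ) ≤ (L : ℝ) ^ (d + 1) := one_le_pow₀ (by exact_mod_cast (NeZero.one_le : 1 ≤ L))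
  have hpos := coercive_extOpR (runA n L a R') _ _ _ _ (σ := min 2 a / (L : ℝ) ^ (d + 1))
    (fun g => (mul_le_mul_of_nonneg_right (div_le_self (lt_min (by norm_num) ha).le hLpow1)
      (by simp only [dotProduct]; exact Finset.sum_nonneg fun _ _ => mul_self_nonneg _)).trans
      (lower18_zero hn ha.le (isBlockUnion_coarse NeZero.one_le hR') g))
    (by rw [hHB]; exact fun u => runB_coercive hn hR' ha u) hs0 hs1 w
  rw [le_div_iff₀ hσ]
  have hc : ∑ x, (w ∘ Sum.inl) x ^ 2 ≤ w ⬝ᵥ w := by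
    rw [dot_self_sum]
    have h2 : 0 ≤ (w ∘ Sum.inr) ⬝ᵥ (w ∘ Sum.inr) := by
      simp only [dotProduct]; exact Finset.sum_nonneg fun _ _ => mul_self_nonneg _
    have h1 : ∑ x, (w ∘ Sum.inl) x ^ 2 = (w ∘ Sum.inl) ⬝ᵥ (w ∘ Sum.inl) := by simp only [dotProduct, sq]
    linarith
  calc (∑ x, (w ∘ Sum.inl) x ^ 2) * (min 2 a / (L : ℝ) ^ (d + 1)) ≤ (w ⬝ᵥ w) * (min 2 a / (L : ℝ) ^ (d + 1)) :=
        mul_le_mul_of_nonneg_right hc hσ.le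
    _ ≤ w ⬝ᵥ (extU1 (isBlockUnion_fine hR') n a s).mulVec w := by rw [mul_comm]; exact hpos

/-- **ENERGY BOUND, CASE B, FOR `𝒫(s)`** (source `(D_ν^⊤f′, 0)`, `supp f′ ⊆ T`): `⟨ŵ, 𝒫(s)ŵ⟩ ≤ 8(1 + 4δ²∕σ)·Σf′²` — the pairing
is moved onto `D_ν(e^{ρ}w_c)` by the weighted Leibniz rule and bounded by the Dirichlet domination, never through `‖D^⊤f′‖ ∼ n‖f′‖`.
[folklore] -/
theorem energyB_ext (hn : 1 ≤ n) (hR' : IsBlockUnion (n * L) R') {a δ : ℝ} (ha : 0 < a) (hδ0 : 0 ≤ δ) (hδ1 : δ ≤ 1)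
    (hsmall : 2 * (2 * ((d : ℝ) + 1) * (δ * L) ^ 2 + a * (Real.exp δ - 1)) ≤ (min 2 a / (L : ℝ) ^ (d + 1)) / 2)
    {s : ℝ} (hs0 : 0 ≤ s) (hs1 : s ≤ 1) (T : Finset ↥(R'.image (blk L))) (hT : T.Nonempty) (ν : Fin (d + 1))
    (f' : ↥(R'.image (blk L)) → ℝ) (hf' : ∀ x, x ∉ T → f' x = 0)
    (w : ↥(R'.image (blk L)) ⊕ (↥(R'.image (blk L)) × NZ d L) → ℝ)
    (hw : ∀ j, w j = Real.exp (rhoT n δ T hT j) *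
      ((extU1 (isBlockUnion_fine hR') n a s)⁻¹.mulVec (Sum.elim (fdiffT n (R'.image (blk L)) ν f') 0)) j) :
    w ⬝ᵥ (extU1 (isBlockUnion_fine hR') n a s).mulVec w ≤
      8 * (1 + 4 * δ ^ 2 / (min 2 a / (L : ℝ) ^ (d + 1))) * ∑ x, f' x ^ 2 := by
  classical
  set σ : ℝ := min 2 a / (L : ℝ) ^ (d + 1) with hσdef
  set H := extU1 (isBlockUnion_fine hR') n a s with hH
  set φ := rhoT (R' := R') n δ T hT with hφ
  have hL0 : (0 : ℝ) < L := by exact_mod_cast (NeZero.one_le : 1 ≤ L)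
  have hσ : 0 < σ := div_pos (lt_min (by norm_num) ha) (by positivity)
  obtain ⟨hpos, herr⟩ := extU1_hyps hn hR' ha hδ0 hδ1 hsmall hs0 hs1 T hT
  have hv : H.mulVec (H⁻¹.mulVec (Sum.elim (fdiffT n (R'.image (blk L)) ν f') 0)) = Sum.elim (fdiffT n (R'.image (blk L)) ν f') 0 := by
    rw [Matrix.mulVec_mulVec, hH, Matrix.mul_nonsing_inv _ (extU1_isUnit_det hn hR' ha hs0 hs1), Matrix.one_mulVec]
  have hE2P := energy_le_two_conjPairing H σ φ hpos herr _ w hw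
  rw [hv] at hE2P
  have hposw := hpos w
  have hww : 0 ≤ w ⬝ᵥ w := by simp only [dotProduct]; exact Finset.sum_nonneg fun _ _ => mul_self_nonneg _
  have hE0 : 0 ≤ w ⬝ᵥ H.mulVec w := le_trans (mul_nonneg hσ.le hww) hposw
  -- the conjugated pairing lives on the coarse sites: `⟨D_ν(e^{φ_c} w_c), f′⟩`
  set wc : ↥(R'.image (blk L)) → ℝ := w ∘ Sum.inl with hwc
  set φc : ↥(R'.image (blk L)) → ℝ := fun x => φ (Sum.inl x) with hφc
  set u : ↥(R'.image (blk L)) → ℝ := fun x => Real.exp (φc x) * wc x with hu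
  have hPeq : ∑ j, w j * (Real.exp (φ j) * (Sum.elim (fdiffT n (R'.image (blk L)) ν f') (0 : ↥(R'.image (blk L)) × NZ d L → ℝ)) j) =
      ∑ x ∈ T, f' x * fdiff n (R'.image (blk L)) ν u x := by
    rw [Fintype.sum_sum_type]
    simp only [Sum.elim_inl, Sum.elim_inr, Pi.zero_apply, mul_zero, Finset.sum_const_zero, add_zero]
    have h1 : ∑ x, w (Sum.inl x) * (Real.exp (φ (Sum.inl x)) * fdiffT n (R'.image (blk L)) ν f' x) = u ⬝ᵥ fdiffT n (R'.image (blk L)) ν f' := by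
      simp only [dotProduct, hu, hφc, hwc, Function.comp]
      exact Finset.sum_congr rfl fun j _ => by ring
    rw [h1, dot_fdiffT]
    simp only [dotProduct]
    rw [← Finset.sum_subset (Finset.subset_univ T)]
    · exact Finset.sum_congr rfl fun x _ => mul_comm _ _
    · intro x _ hx
      rw [hf' x hx, mul_zero]
  rw [hPeq] at hE2P
  have hLip : ∀ (x : ↥(R'.image (blk L))) (h : x.1 + uvec ν ∈ R'.image (blk L)), |φc ⟨x.1 + uvec ν, h⟩ - φc x| ≤ δ / (n : ℝ) :=
    fun x h => rhoT_lip_step hn hδ0 T hT ν x h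
  have hUx : ∀ x ∈ T, fdiff n (R'.image (blk L)) ν u x ^ 2 ≤ 2 * (fdiff n (R'.image (blk L)) ν wc x ^ 2 + 4 * δ ^ 2 * extR wc (x.1 + uvec ν) ^ 2) := by
    intro x hx
    have h1 := abs_fdiff_weighted_le hn hδ1 φc wc u (fun j => rfl) ν hLip x
    have h2 : Real.exp (φc x) ≤ 1 := by
      rw [← Real.exp_zero]
      exact Real.exp_le_exp.2 (mul_nonpos_iff.2 (Or.inl ⟨hδ0, dT_le_zero_of_mem T hT hx⟩))
    have h3 : 0 ≤ |fdiff n (R'.image (blk L)) ν wc x| + 2 * δ * |extR wc (x.1 + uvec ν)| := by positivity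
    have h4 : |fdiff n (R'.image (blk L)) ν u x| ≤ |fdiff n (R'.image (blk L)) ν wc x| + 2 * δ * |extR wc (x.1 + uvec ν)| :=
      h1.trans ((mul_le_mul_of_nonneg_right h2 h3).trans (by rw [one_mul]))
    have h5 : fdiff n (R'.image (blk L)) ν u x ^ 2 ≤ (|fdiff n (R'.image (blk L)) ν wc x| + 2 * δ * |extR wc (x.1 + uvec ν)|) ^ 2 := by
      rw [← sq_abs (fdiff n (R'.image (blk L)) ν u x)]
      exact pow_le_pow_left₀ (abs_nonneg _) h4 2
    have h6 : (|fdiff n (R'.image (blk L)) ν wc x| + 2 * δ * |extR wc (x.1 + uvec ν)|) ^ 2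
        ≤ 2 * (|fdiff n (R'.image (blk L)) ν wc x| ^ 2 + (2 * δ * |extR wc (x.1 + uvec ν)|) ^ 2) := by
      nlinarith [sq_nonneg (|fdiff n (R'.image (blk L)) ν wc x| - 2 * δ * |extR wc (x.1 + uvec ν)|)]
    calc fdiff n (R'.image (blk L)) ν u x ^ 2 ≤ _ := h5
      _ ≤ _ := h6
      _ = 2 * (fdiff n (R'.image (blk L)) ν wc x ^ 2 + 4 * δ ^ 2 * extR wc (x.1 + uvec ν) ^ 2) := by
          rw [sq_abs, mul_pow, mul_pow, sq_abs]; ring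
  have hDw : ∑ x, fdiff n (R'.image (blk L)) ν wc x ^ 2 ≤ w ⬝ᵥ H.mulVec w := sum_fdiff_sq_le_extU1 hn hR' ha hs0 ν w
  have hshift : ∑ x ∈ T, extR wc (x.1 + uvec ν) ^ 2 ≤ ∑ x, wc x ^ 2 := sum_sq_shift_le ν wc T
  have hwwE : ∑ x, wc x ^ 2 ≤ w ⬝ᵥ H.mulVec w / σ := coarse_normSq_le_energy hn hR' ha hs0 hs1 w
  have hDT : ∑ x ∈ T, fdiff n (R'.image (blk L)) ν wc x ^ 2 ≤ ∑ x, fdiff n (R'.image (blk L)) ν wc x ^ 2 :=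
    Finset.sum_le_sum_of_subset_of_nonneg (Finset.subset_univ T) fun x _ _ => sq_nonneg _
  have hU : ∑ x ∈ T, fdiff n (R'.image (blk L)) ν u x ^ 2 ≤ 2 * (1 + 4 * δ ^ 2 / σ) * (w ⬝ᵥ H.mulVec w) := by
    calc ∑ x ∈ T, fdiff n (R'.image (blk L)) ν u x ^ 2
        ≤ ∑ x ∈ T, 2 * (fdiff n (R'.image (blk L)) ν wc x ^ 2 + 4 * δ ^ 2 * extR wc (x.1 + uvec ν) ^ 2) := Finset.sum_le_sum hUx
      _ = 2 * ∑ x ∈ T, fdiff n (R'.image (blk L)) ν wc x ^ 2 + 8 * δ ^ 2 * ∑ x ∈ T, extR wc (x.1 + uvec ν) ^ 2 := by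
          rw [Finset.mul_sum, Finset.mul_sum, ← Finset.sum_add_distrib]
          exact Finset.sum_congr rfl fun x _ => by ring
      _ ≤ 2 * (w ⬝ᵥ H.mulVec w) + 8 * δ ^ 2 * (w ⬝ᵥ H.mulVec w / σ) :=
          add_le_add (mul_le_mul_of_nonneg_left (hDT.trans hDw) (by norm_num))
            (mul_le_mul_of_nonneg_left (hshift.trans hwwE) (by positivity))
      _ = 2 * (1 + 4 * δ ^ 2 / σ) * (w ⬝ᵥ H.mulVec w) := by ring
  have hP2 : (∑ x ∈ T, f' x * fdiff n (R'.image (blk L)) ν u x) ^ 2 ≤ 2 * (1 + 4 * δ ^ 2 / σ) * (∑ j, f' j ^ 2) * (w ⬝ᵥ H.mulVec w) := by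
    have hf'T : ∑ x ∈ T, f' x ^ 2 ≤ ∑ j, f' j ^ 2 :=
      Finset.sum_le_sum_of_subset_of_nonneg (Finset.subset_univ T) fun x _ _ => sq_nonneg _
    calc (∑ x ∈ T, f' x * fdiff n (R'.image (blk L)) ν u x) ^ 2 ≤ (∑ x ∈ T, f' x ^ 2) * ∑ x ∈ T, fdiff n (R'.image (blk L)) ν u x ^ 2 := sq_sum_mul_le T _ _
      _ ≤ (∑ j, f' j ^ 2) * (2 * (1 + 4 * δ ^ 2 / σ) * (w ⬝ᵥ H.mulVec w)) :=
          mul_le_mul hf'T hU (Finset.sum_nonneg fun x _ => sq_nonneg _) (Finset.sum_nonneg fun x _ => sq_nonneg _)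
      _ = 2 * (1 + 4 * δ ^ 2 / σ) * (∑ j, f' j ^ 2) * (w ⬝ᵥ H.mulVec w) := by ring
  have h := le_four_mul_of_sq_le hE0 (by positivity) hE2P hP2
  calc w ⬝ᵥ H.mulVec w ≤ 4 * (2 * (1 + 4 * δ ^ 2 / σ) * ∑ j, f' j ^ 2) := h
    _ = 8 * (1 + 4 * δ ^ 2 / σ) * ∑ j, f' j ^ 2 := by ring

/-- **VALUES ON `S` FROM THE EXTENDED ENERGY**: `Σ_{x∈S} v_c(x)² ≤ e^{−2δρ₀}·E∕σ` when `dist_η(S,T) ≥ ρ₀`, `w_c = e^{φ_c}v_c`. [folklore] -/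
theorem sum_sq_le_extEnergy (hn : 1 ≤ n) (hR' : IsBlockUnion (n * L) R') {a δ : ℝ} (ha : 0 < a) (hδ0 : 0 ≤ δ) {s : ℝ}
    (hs0 : 0 ≤ s) (hs1 : s ≤ 1) (T : Finset ↥(R'.image (blk L))) (hT : T.Nonempty) (S : Finset ↥(R'.image (blk L)))
    (ρ₀ : ℝ) (hρ₀ : ∀ x ∈ S, ∀ t ∈ T, ρ₀ ≤ edistR n (R'.image (blk L)) x t)
    (v w : ↥(R'.image (blk L)) ⊕ (↥(R'.image (blk L)) × NZ d L) → ℝ) (hw : ∀ j, w j = Real.exp (rhoT n δ T hT j) * v j) :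
    ∑ x ∈ S, (v ∘ Sum.inl) x ^ 2 ≤
      Real.exp (-(2 * (δ * ρ₀))) / (min 2 a / (L : ℝ) ^ (d + 1)) * (w ⬝ᵥ (extU1 (isBlockUnion_fine hR') n a s).mulVec w) := by
  have hL0 : (0 : ℝ) < L := by exact_mod_cast (NeZero.one_le : 1 ≤ L)
  have hσ : 0 < min 2 a / (L : ℝ) ^ (d + 1) := div_pos (lt_min (by norm_num) ha) (by positivity)
  have h1 := setSq_le_of_weightedSq (fun x => rhoT n δ T hT (Sum.inl x)) (v ∘ Sum.inl) S (δ * ρ₀)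
    (fun x hx => mul_le_mul_of_nonneg_left (le_dT T hT fun t ht => hρ₀ x hx t ht) hδ0)
  have h2 : ∑ x, (Real.exp (rhoT n δ T hT (Sum.inl x)) * (v ∘ Sum.inl) x) ^ 2 = ∑ x, (w ∘ Sum.inl) x ^ 2 :=
    Finset.sum_congr rfl fun x _ => by rw [Function.comp_apply, Function.comp_apply, hw]
  rw [h2] at h1
  have h3 := coarse_normSq_le_energy hn hR' ha hs0 hs1 w
  calc ∑ x ∈ S, (v ∘ Sum.inl) x ^ 2 ≤ Real.exp (-(2 * (δ * ρ₀))) * ∑ x, (w ∘ Sum.inl) x ^ 2 := h1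
    _ ≤ Real.exp (-(2 * (δ * ρ₀))) * ((w ⬝ᵥ (extU1 (isBlockUnion_fine hR') n a s).mulVec w) / (min 2 a / (L : ℝ) ^ (d + 1))) :=
        mul_le_mul_of_nonneg_left h3 (Real.exp_pos _).le
    _ = _ := by ring

/-- **GRADIENTS ON `S` FROM THE EXTENDED ENERGY**: `Σ_{x∈S}(D_μv_c)(x)² ≤ 2e^{−2δρ₀}(1 + 4δ²∕σ)·E` when `dist_η(S,T) ≥ ρ₀` (weighted
Leibniz on run A's sites + the Dirichlet domination). [folklore] -/
theorem sum_fdiff_sq_le_extEnergy (hn : 1 ≤ n) (hR' : IsBlockUnion (n * L) R') {a δ : ℝ} (ha : 0 < a) (hδ0 : 0 ≤ δ)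
    (hδ1 : δ ≤ 1) {s : ℝ} (hs0 : 0 ≤ s) (hs1 : s ≤ 1) (T : Finset ↥(R'.image (blk L))) (hT : T.Nonempty)
    (S : Finset ↥(R'.image (blk L))) (ρ₀ : ℝ) (hρ₀ : ∀ x ∈ S, ∀ t ∈ T, ρ₀ ≤ edistR n (R'.image (blk L)) x t)
    (v w : ↥(R'.image (blk L)) ⊕ (↥(R'.image (blk L)) × NZ d L) → ℝ) (hw : ∀ j, w j = Real.exp (rhoT n δ T hT j) * v j)
    (μ : Fin (d + 1)) :
    ∑ x ∈ S, fdiff n (R'.image (blk L)) μ (v ∘ Sum.inl) x ^ 2 ≤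
      2 * Real.exp (-(2 * (δ * ρ₀))) * (1 + 4 * δ ^ 2 / (min 2 a / (L : ℝ) ^ (d + 1))) *
        (w ⬝ᵥ (extU1 (isBlockUnion_fine hR') n a s).mulVec w) := by
  classical
  set σ : ℝ := min 2 a / (L : ℝ) ^ (d + 1) with hσdef
  set H := extU1 (isBlockUnion_fine hR') n a s with hH
  have hL0 : (0 : ℝ) < L := by exact_mod_cast (NeZero.one_le : 1 ≤ L)
  have hσ : 0 < σ := div_pos (lt_min (by norm_num) ha) (by positivity)
  set vc : ↥(R'.image (blk L)) → ℝ := v ∘ Sum.inl with hvc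
  set wc : ↥(R'.image (blk L)) → ℝ := w ∘ Sum.inl with hwc
  set φc : ↥(R'.image (blk L)) → ℝ := fun x => rhoT n δ T hT (Sum.inl x) with hφc
  have hwc' : ∀ j, wc j = Real.exp (φc j) * vc j := fun j => by
    simp only [hwc, hvc, hφc, Function.comp_apply]
    exact hw (Sum.inl j)
  have hLip : ∀ (x : ↥(R'.image (blk L))) (h : x.1 + uvec μ ∈ R'.image (blk L)), |φc ⟨x.1 + uvec μ, h⟩ - φc x| ≤ δ / (n : ℝ) :=
    fun x h => rhoT_lip_step hn hδ0 T hT μ x h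
  have hx : ∀ x ∈ S, fdiff n (R'.image (blk L)) μ vc x ^ 2
      ≤ Real.exp (-(2 * (δ * ρ₀))) * (2 * (fdiff n (R'.image (blk L)) μ wc x ^ 2 + 4 * δ ^ 2 * extR wc (x.1 + uvec μ) ^ 2)) := by
    intro x hxS
    have h1 := exp_mul_abs_fdiff_le hn hδ1 φc vc wc hwc' μ hLip x
    have hlo : δ * ρ₀ ≤ φc x := mul_le_mul_of_nonneg_left (le_dT T hT fun t ht => hρ₀ x hxS t ht) hδ0
    have h2 : Real.exp (δ * ρ₀) * |fdiff n (R'.image (blk L)) μ vc x| ≤ |fdiff n (R'.image (blk L)) μ wc x| + 2 * δ * |extR wc (x.1 + uvec μ)| :=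
      (mul_le_mul_of_nonneg_right (Real.exp_le_exp.2 hlo) (abs_nonneg _)).trans h1
    have h3 : (Real.exp (δ * ρ₀) * |fdiff n (R'.image (blk L)) μ vc x|) ^ 2 ≤ 2 * (fdiff n (R'.image (blk L)) μ wc x ^ 2 + 4 * δ ^ 2 * extR wc (x.1 + uvec μ) ^ 2) := by
      have h4 := pow_le_pow_left₀ (by positivity) h2 2
      refine h4.trans ?_
      rw [← sq_abs (fdiff n (R'.image (blk L)) μ wc x), ← sq_abs (extR wc (x.1 + uvec μ))]
      nlinarith [sq_nonneg (|fdiff n (R'.image (blk L)) μ wc x| - 2 * δ * |extR wc (x.1 + uvec μ)|), abs_nonneg (fdiff n (R'.image (blk L)) μ wc x),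
        abs_nonneg (extR wc (x.1 + uvec μ)), hδ0]
    have hexp2 : Real.exp (δ * ρ₀) ^ 2 * Real.exp (-(2 * (δ * ρ₀))) = 1 := by
      rw [← Real.exp_nat_mul, ← Real.exp_add]; push_cast; ring_nf; exact Real.exp_zero
    have h5 : fdiff n (R'.image (blk L)) μ vc x ^ 2 = Real.exp (-(2 * (δ * ρ₀))) * (Real.exp (δ * ρ₀) * |fdiff n (R'.image (blk L)) μ vc x|) ^ 2 := by
      rw [mul_pow, sq_abs, ← mul_assoc, mul_comm (Real.exp _), hexp2, one_mul]
    rw [h5]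
    exact mul_le_mul_of_nonneg_left h3 (Real.exp_pos _).le
  have hDw : ∑ x, fdiff n (R'.image (blk L)) μ wc x ^ 2 ≤ w ⬝ᵥ H.mulVec w := sum_fdiff_sq_le_extU1 hn hR' ha hs0 μ w
  have hshift : ∑ x ∈ S, extR wc (x.1 + uvec μ) ^ 2 ≤ ∑ x, wc x ^ 2 := sum_sq_shift_le μ wc S
  have hwwE : ∑ x, wc x ^ 2 ≤ w ⬝ᵥ H.mulVec w / σ := coarse_normSq_le_energy hn hR' ha hs0 hs1 w
  have hDS : ∑ x ∈ S, fdiff n (R'.image (blk L)) μ wc x ^ 2 ≤ ∑ x, fdiff n (R'.image (blk L)) μ wc x ^ 2 :=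
    Finset.sum_le_sum_of_subset_of_nonneg (Finset.subset_univ S) fun x _ _ => sq_nonneg _
  calc ∑ x ∈ S, fdiff n (R'.image (blk L)) μ vc x ^ 2
      ≤ ∑ x ∈ S, Real.exp (-(2 * (δ * ρ₀))) * (2 * (fdiff n (R'.image (blk L)) μ wc x ^ 2 + 4 * δ ^ 2 * extR wc (x.1 + uvec μ) ^ 2)) :=
        Finset.sum_le_sum hx
    _ = Real.exp (-(2 * (δ * ρ₀))) * (2 * ∑ x ∈ S, fdiff n (R'.image (blk L)) μ wc x ^ 2 + 8 * δ ^ 2 * ∑ x ∈ S, extR wc (x.1 + uvec μ) ^ 2) := by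
        rw [← Finset.mul_sum]
        congr 1
        rw [Finset.mul_sum, Finset.mul_sum, ← Finset.sum_add_distrib]
        exact Finset.sum_congr rfl fun x _ => by ring
    _ ≤ Real.exp (-(2 * (δ * ρ₀))) * (2 * (w ⬝ᵥ H.mulVec w) + 8 * δ ^ 2 * (w ⬝ᵥ H.mulVec w / σ)) := by
        refine mul_le_mul_of_nonneg_left (add_le_add ?_ ?_) (Real.exp_pos _).le
        · exact mul_le_mul_of_nonneg_left (hDS.trans hDw) (by norm_num)
        · exact mul_le_mul_of_nonneg_left (hshift.trans hwwE) (by positivity)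
    _ = 2 * Real.exp (-(2 * (δ * ρ₀))) * (1 + 4 * δ ^ 2 / σ) * (w ⬝ᵥ H.mulVec w) := by ring

end Energy

end Summit.QuantumFields.BalabanUV.T4Continuum.NE7K1LinSchurLineU1Energy
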